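import Summits.BirchSwinnertonDyer.BirchSwinnertonDyer.Theorems.BiquadraticEisensteinDescentHeegnerTwistCouplingInSupplySqrtSevenRungs
import Summits.BirchSwinnertonDyer.BirchSwinnertonDyer.Theorems.Rank2ObservatoryKrausCert
import HarnessLib

set_option linter.dupNamespace false -- `Summit.BirchSwinnertonDyer.BirchSwinnertonDyer.Theorems.…` (summit = sub)
set_option autoImplicit false

/-!
# Crux `HeegnerTwistCouplingInSupply` (stmt-BirchSwinnertonDyer-21381) — the `j = −3375` rungs: the crux BINDERS are inhabited by
# `W⁻_p = ⟨0, −21p, 0, 112p², 0⟩` for `p ≡ 1 (mod 4)` (global minimality by Kraus at `2`, `N ≠ 0`, CM)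

Route `BiquadraticEisensteinDescent` (cell `pub/bsd-wall`, width seat `bsd-wall-cm-bed-w1` g11; `--supports` 21381, helper). Companion of `…SqrtSevenRungs`
(the `p ≡ 1 (mod 4)` inert half of `j = −3375`, fixed Heegner fields `ℚ(√−q₃q₅q₁)`). There the corner curve is the two-torsion model
`W⁻_p = ⟨0, −21p, 0, 112p², 0⟩` of `X₀(49)^{(−p)}`; here: for every prime `p ≡ 1 (mod 4)` it IS a global minimal Weierstrass equation (so the crux's
binder `[W.IsGloballyMinimal]` is satisfied and the rungs are not vacuous): `c₄ = 1680p² = 2⁴·105·p²` (`2⁸ ∤ c₄`), `c₆ + 64 = 64(1 − 1323p³)` with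
`1 − 1323p³ ≡ 2 (mod 4)` for `p ≡ 1 (mod 4)` (`2⁸ ∤ c₆ + 64`: Kraus at `2`), and `q⁴ ∤ c₄` at every odd prime `q` (`105` is square-free) — the tree's
`Rank2Observatory.isGloballyMinimal_baseChange_int_of_kraus₄`. (For `p ≡ 3 (mod 4)` this model is NOT minimal at `2`; the minimal one is
`…SqrtSevenCorner`'s `W_p = ⟨1, −(21p+1)/4, 0, 7p², 0⟩`.) Also `N(W⁻_p) ≠ 0` and `HasCM` (`…SqrtSevenRungs.j_Wneg_and_hasCM`).

HONEST FRAMING: bookkeeping on one CM family; nothing about the crux (C⁺) or BSD is proved. THEOREMS ONLY.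
-/

noncomputable section

open scoped Classical NumberField

namespace Summit.BirchSwinnertonDyer.BirchSwinnertonDyer.Theorems.BiquadraticEisensteinDescentHeegnerTwistCouplingInSupplySqrtSevenRungsMinimal

open _root_.WeierstrassCurve Literature.NumberTheory.EllipticCurves Literature.NumberTheory
open Summit.BirchSwinnertonDyer.BirchSwinnertonDyer.Rank2Observatory (isGloballyMinimal_baseChange_int_of_kraus₄)
open Summit.BirchSwinnertonDyer.BirchSwinnertonDyer.Theorems.BiquadraticEisensteinDescentHeegnerTwistCouplingInSupplySqrtSevenRungs

/-- `c₄(W⁻_p) = 1680 p²` (over `ℤ`). [cite: SilvermanAEC2009, III.1] -/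
theorem WnegInt_c₄ (p : ℕ) : (⟨0, -21 * (p : ℤ), 0, 112 * (p : ℤ) ^ 2, 0⟩ : WeierstrassCurve ℤ).c₄ = 1680 * (p : ℤ) ^ 2 := by
  simp only [WeierstrassCurve.c₄, WeierstrassCurve.b₂, WeierstrassCurve.b₄]
  ring

/-- `c₆(W⁻_p) = −84672 p³ = −64·1323·p³` (over `ℤ`). [cite: SilvermanAEC2009, III.1] -/
theorem WnegInt_c₆ (p : ℕ) : (⟨0, -21 * (p : ℤ), 0, 112 * (p : ℤ) ^ 2, 0⟩ : WeierstrassCurve ℤ).c₆ = -84672 * (p : ℤ) ^ 3 := by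
  simp only [WeierstrassCurve.c₆, WeierstrassCurve.b₂, WeierstrassCurve.b₄, WeierstrassCurve.b₆]
  ring

/-- The base change of the `ℤ`-model is the rung literal `W⁻_p`. [folklore] -/
theorem baseChange_WnegInt (p : ℕ) :
    (⟨0, -21 * (p : ℤ), 0, 112 * (p : ℤ) ^ 2, 0⟩ : WeierstrassCurve ℤ).baseChange ℚ = ⟨0, -21 * (p : ℚ), 0, 112 * (p : ℚ) ^ 2, 0⟩ := by
  ext <;> simp [WeierstrassCurve.baseChange, WeierstrassCurve.map]

/-- `q⁴ ∤ 1680 p²` for an odd prime `q` and an odd prime `p` (`1680 = 2⁴·105`, `105` square-free). [folklore] -/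
theorem not_pow_four_dvd_c₄ {p q : ℕ} (hp : p.Prime) (hp2 : p ≠ 2) (hq : q.Prime) (hq2 : q ≠ 2) : ¬ (q : ℤ) ^ 4 ∣ 1680 * (p : ℤ) ^ 2 := by
  intro h
  have h' : q ^ 4 ∣ 1680 * p ^ 2 := by exact_mod_cast h
  by_cases hqp : q = p
  · subst hqp
    -- `q⁴ ∣ 1680 q²` ⇒ `q² ∣ 1680 = 105·16` ⇒ (`q` odd) `q² ∣ 105` ⇒ `q ≤ 10`, but `9, 25, 49 ∤ 105`
    have h2 : q ^ 2 ∣ 1680 := by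
      have h'' : q ^ 2 * q ^ 2 ∣ q ^ 2 * 1680 := by rw [← pow_add, mul_comm]; exact h'
      exact (Nat.mul_dvd_mul_iff_left (pow_pos hq.pos 2)).mp h''
    have hcop : Nat.Coprime (q ^ 2) 16 := Nat.Coprime.pow 2 4 ((Nat.coprime_primes hq Nat.prime_two).mpr hq2)
    have h105 : q ^ 2 ∣ 105 := hcop.dvd_of_dvd_mul_right (by rw [show (16 : ℕ) * 105 = 1680 by norm_num]; exact h2)
    have hle : q ^ 2 ≤ 105 := Nat.le_of_dvd (by norm_num) h105
    have hq11 : q < 11 := by nlinarith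
    interval_cases q <;> first | omega | exact absurd hq (by norm_num)
  · -- `q ≠ p`: `q⁴ ∣ 1680`, so `q ≤ 6`, `q ∈ {3, 5}`, but `81 ∤ 1680`, `625 ∤ 1680`
    have hcop : Nat.Coprime (q ^ 4) (p ^ 2) := Nat.Coprime.pow 4 2 ((Nat.coprime_primes hq hp).mpr hqp)
    have h1680 : q ^ 4 ∣ 1680 := hcop.dvd_of_dvd_mul_right h'
    have hle : q ^ 4 ≤ 1680 := Nat.le_of_dvd (by norm_num) h1680
    have hq7 : q < 7 := by
      by_contra hge
      push Not at hge
      have : 7 ^ 4 ≤ q ^ 4 := Nat.pow_le_pow_left hge 4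
      omega
    interval_cases q <;> simp_all (config := {decide := true})

/-- ★ **`W⁻_p = ⟨0, −21p, 0, 112p², 0⟩` is a global minimal Weierstrass equation for every prime `p ≡ 1 (mod 4)`** (Kraus at `2`: `2⁸ ∤ c₄ = 2⁴·105p²`,
`2⁸ ∤ c₆ + 64 = 64(1 − 1323p³)` as `1 − 1323p³ ≡ 2 (mod 4)`; Silverman at odd `q`: `q⁴ ∤ c₄`). [cite: Kraus1989, Prop. 2] [cite: SilvermanAEC2009, VII.1 Remark 1.1] -/
theorem isGloballyMinimal_Wneg {p : ℕ} (hp : p.Prime) (hp4 : p % 4 = 1) :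
    (⟨0, -21 * (p : ℚ), 0, 112 * (p : ℚ) ^ 2, 0⟩ : WeierstrassCurve ℚ).IsGloballyMinimal := by
  rw [← baseChange_WnegInt]
  have hp2 : p ≠ 2 := by rintro rfl; omega
  refine isGloballyMinimal_baseChange_int_of_kraus₄ _ ?_ ?_ ?_
  · rw [WnegInt_c₄]
    intro h
    -- `2⁸ ∣ 2⁴·105·p²` ⇒ `16 ∣ 105 p²`, impossible for `p` odd
    have h16 : (16 : ℤ) ∣ 105 * (p : ℤ) ^ 2 := by
      rw [show (2 : ℤ) ^ 8 = 16 * 16 by norm_num, show (1680 : ℤ) * (p : ℤ) ^ 2 = 16 * (105 * (p : ℤ) ^ 2) by ring] at h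
      exact (mul_dvd_mul_iff_left (by norm_num)).mp h
    have h2 : (2 : ℤ) ∣ 105 * (p : ℤ) ^ 2 := dvd_trans ⟨8, by norm_num⟩ h16
    have hp2' : (p : ℤ) % 2 = 1 := by omega
    have hodd : (105 * (p : ℤ) ^ 2) % 2 = 1 := by
      rw [Int.mul_emod, pow_two, Int.mul_emod (p : ℤ) (p : ℤ), hp2']; norm_num
    omega
  · rw [WnegInt_c₆]
    intro h
    -- `2⁸ ∣ 64(1 − 1323p³)` ⇒ `4 ∣ 1 − 1323 p³`, but `1 − 1323p³ ≡ 2 (mod 4)` for `p ≡ 1 (mod 4)`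
    have h4 : (4 : ℤ) ∣ 1 - 1323 * (p : ℤ) ^ 3 := by
      rw [show (2 : ℤ) ^ 8 = 64 * 4 by norm_num, show (-84672 * (p : ℤ) ^ 3 + 64) = 64 * (1 - 1323 * (p : ℤ) ^ 3) by ring] at h
      exact (mul_dvd_mul_iff_left (by norm_num)).mp h
    have hp4' : (p : ℤ) % 4 = 1 := by omega
    have : (1 - 1323 * (p : ℤ) ^ 3) % 4 = 2 := by
      rw [Int.sub_emod, Int.mul_emod, pow_three, Int.mul_emod (p : ℤ), Int.mul_emod (p : ℤ) (p : ℤ), hp4']; decide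
    omega
  · intro q hq hq2 ⟨_, h4⟩
    rw [WnegInt_c₄] at h4
    exact not_pow_four_dvd_c₄ hp hp2 hq hq2 h4

/-- `N(W⁻_p) ≠ 0` (the crux binder; tree theorem `conductorNorm_pos_holds`). [folklore] -/
theorem neZero_conductorNorm_Wneg (p : ℕ) [(⟨0, -21 * (p : ℚ), 0, 112 * (p : ℚ) ^ 2, 0⟩ : WeierstrassCurve ℚ).IsElliptic] :
    NeZero ((⟨0, -21 * (p : ℚ), 0, 112 * (p : ℚ) ^ 2, 0⟩ : WeierstrassCurve ℚ).conductorNorm ℤ) :=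
  ⟨((⟨0, -21 * (p : ℚ), 0, 112 * (p : ℚ) ^ 2, 0⟩ : WeierstrassCurve ℚ).conductorNorm_pos_holds).ne'⟩

/-- All binders/hypotheses of the crux are inhabited by `W⁻_p` for every prime `p ≡ 1 (mod 4)` (so the rungs of `…SqrtSevenRungs` are not vacuous):
`IsElliptic`, `IsGloballyMinimal`, `NeZero N`, `HasCM`. [cite: SilvermanAEC2009, VII.1 Remark 1.1] -/
theorem binders_Wneg {p : ℕ} (hp : p.Prime) (hp4 : p % 4 = 1) :
    ∃ (_ : (⟨0, -21 * (p : ℚ), 0, 112 * (p : ℚ) ^ 2, 0⟩ : WeierstrassCurve ℚ).IsElliptic)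
      (_ : (⟨0, -21 * (p : ℚ), 0, 112 * (p : ℚ) ^ 2, 0⟩ : WeierstrassCurve ℚ).IsGloballyMinimal)
      (_ : NeZero ((⟨0, -21 * (p : ℚ), 0, 112 * (p : ℚ) ^ 2, 0⟩ : WeierstrassCurve ℚ).conductorNorm ℤ)),
      (⟨0, -21 * (p : ℚ), 0, 112 * (p : ℚ) ^ 2, 0⟩ : WeierstrassCurve ℚ).HasCM := by
  haveI := isElliptic_Wneg p hp
  exact ⟨inferInstance, isGloballyMinimal_Wneg hp hp4, neZero_conductorNorm_Wneg p, (j_Wneg_and_hasCM hp).2⟩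

end Summit.BirchSwinnertonDyer.BirchSwinnertonDyer.Theorems.BiquadraticEisensteinDescentHeegnerTwistCouplingInSupplySqrtSevenRungsMinimal

end
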